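import Summits.KontsevichZagierPeriods.KontsevichZagierPeriods.Theorems.StuffleInKZ.Negative.DefectMarginal
import Summits.KontsevichZagierPeriods.KontsevichZagierPeriods.Theorems.StuffleInKZ.Negative.GrowthTranscendence
import Summits.KontsevichZagierPeriods.KontsevichZagierPeriods.Theorems.StuffleInKZ.Negative.ChangeOfVariablesFree

/-!
# `StuffleInKZ` (stmt-3931), negative side, cycle 3 Part II — A CHANGE OF VARIABLES IS NECESSARY
# for the stuffle: the (2,2) defect has no algebraic shadow

`sliceEval D x = (ζ₂ ℓ(x) − 2 Li_{1,2}(x) − Li₃(x))/x` on `(0,1)` (`DefectMarginal.lean`), where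
`ℓ(x) = −log(1−x)`. Elementary bounds (`ℝ≥0∞` series, then `toReal`):
`Li₃(x) ≤ ζ₂`, `Li_{1,2}(x) ≤ ζ₂ ℓ(x)`, `ζ₂ ℓ(x) ≤ Li_{1,2}(x) + 2ζ₂` (tail of `Σ 1/m²` by
telescoping); hence `x · sliceEval D x = −ζ₂ ℓ(x) + O(1)`: the marginal tends to `−∞` as
`x → 1⁻` but SUB-POLYNOMIALLY (`(1−x) ρ(x)^k → 0`). By the growth-transcendence lemma
(`GrowthTranscendence.lean`) such a function satisfies no polynomial identity near `1⁻`, even along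
the full-measure set where it agrees with a putative semialgebraic shadow; so
`¬ HasAlgShadow (defect Zcan [2] [2])` (`defect_two_two_not_hasAlgShadow`) and

  `not_stuffleInCovFree : ¬ StuffleInCovFree` — EVERY MOVE CHAIN FOR THE STUFFLE USES RULE (2);
  sharper, `not_stuffleInFibredNL`: some change of variables of the chain must MOVE the first
  coordinate (`defect_two_two_not_mem_closure_fibred_nl`, via `closure_fibred_nl_le_algShadow`).

With `not_stuffleInCovNL` (`LoadBearing.lean`): a chain for the stuffle uses at least one additivity
move and at least one change of variables; Newton–Leibniz is the only dispensable rule (the cubical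
chain, Soudères 2010, uses (1b) + (2) only). [folklore]
-/

noncomputable section

namespace Summit.KontsevichZagierPeriods.Theorems.StuffleInKZ.Negative

namespace Necessary

open MeasureTheory Set Filter ENNReal
open scoped Topology
open Literature.NumberTheory.Transcendental
open Literature.NumberTheory.Transcendental.KZ
open Literature.NumberTheory.Transcendental.MZV (IsAdmissible)
open Series Slices

/-! ### Bounds for the `ℝ≥0∞` series -/

/-- `Li₃(x) ≤ ζ₂` for `0 ≤ x ≤ 1`. [folklore] -/
theorem li3E_le {x : ℝ} (hx0 : 0 ≤ x) (hx1 : x ≤ 1) : li3E x ≤ li2E 1 := by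
  rw [li3E, li2E]
  refine ENNReal.tsum_le_tsum fun m => ?_
  rw [← ENNReal.ofReal_mul (by positivity), ← ENNReal.ofReal_mul (by positivity)]
  apply ENNReal.ofReal_le_ofReal
  have hm : (0 : ℝ) < m + 1 := by positivity
  have hxm : x ^ (m + 1) ≤ 1 := pow_le_one₀ hx0 hx1
  rw [one_pow]
  have h1 : x ^ (m + 1) / ((m : ℝ) + 1) ≤ 1 / ((m : ℝ) + 1) := div_le_div_of_nonneg_right hxm hm.le
  have h2 : 1 / ((m : ℝ) + 1) ≤ 1 := by rw [div_le_one hm]; linarith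
  calc 1 / ((m : ℝ) + 1) ^ 2 * (x ^ (m + 1) / ((m : ℝ) + 1))
      ≤ 1 / ((m : ℝ) + 1) ^ 2 * (1 / ((m : ℝ) + 1)) := mul_le_mul_of_nonneg_left h1 (by positivity)
    _ ≤ 1 / ((m : ℝ) + 1) ^ 2 * 1 := mul_le_mul_of_nonneg_left h2 (by positivity)
    _ = 1 / ((m : ℝ) + 1) * (1 / ((m : ℝ) + 1)) := by rw [mul_one, sq, div_mul_div_comm, one_mul]

/-- `Li_{1,2}(x) ≤ ζ₂ · ℓ(x)` for `0 ≤ x ≤ 1`. [folklore] -/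
theorem li12E_le {x : ℝ} (hx0 : 0 ≤ x) (hx1 : x ≤ 1) : li12E x ≤ li2E 1 * ellE x := by
  rw [li12E, li2E_one, ellE, ← ENNReal.tsum_mul_right]
  simp_rw [← ENNReal.tsum_mul_left]
  rw [← ENNReal.tsum_prod]
  refine ENNReal.tsum_le_tsum fun p => ?_
  refine mul_le_mul' le_rfl (ENNReal.ofReal_le_ofReal ?_)
  have hk : (0 : ℝ) < p.2 + 1 := by positivity
  have hpow : x ^ (p.1 + 1 + p.2 + 1) ≤ x ^ (p.2 + 1) :=
    pow_le_pow_of_le_one hx0 hx1 (by omega)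
  push_cast
  calc x ^ (p.1 + 1 + p.2 + 1) / ((p.1 : ℝ) + 1 + p.2 + 1)
      ≤ x ^ (p.2 + 1) / ((p.1 : ℝ) + 1 + p.2 + 1) := div_le_div_of_nonneg_right hpow (by positivity)
    _ ≤ x ^ (p.2 + 1) / ((p.2 : ℝ) + 1) :=
        div_le_div_of_nonneg_left (by positivity) hk (by linarith [p.1.cast_nonneg (α := ℝ)])

/-- Telescoping tail bound: `Σ_{j<M} 1/(j+N+2)² ≤ 1/(N+1)`. [folklore] -/
theorem sum_inv_sq_tail_le (N M : ℕ) :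
    ∑ j ∈ Finset.range M, 1 / ((j : ℝ) + N + 2) ^ 2 ≤ 1 / ((N : ℝ) + 1) := by
  set f : ℕ → ℝ := fun j => 1 / ((j : ℝ) + N + 1) with hf
  have hle : ∀ j ∈ Finset.range M, 1 / ((j : ℝ) + N + 2) ^ 2 ≤ f j - f (j + 1) := by
    intro j _
    simp only [hf]
    push_cast
    have h1 : (0 : ℝ) < j + N + 1 := by positivity
    have h2 : (0 : ℝ) < j + N + 2 := by positivity
    rw [show (j : ℝ) + 1 + N + 1 = j + N + 2 by ring, div_sub_div _ _ h1.ne' h2.ne',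
      div_le_div_iff₀ (by positivity) (by positivity)]
    nlinarith
  refine (Finset.sum_le_sum hle).trans ?_
  rw [Finset.sum_range_sub' f M]
  simp only [hf, Nat.cast_zero, zero_add]
  have : 0 ≤ 1 / ((M : ℝ) + N + 1) := by positivity
  linarith

/-- `ζ₂ ≤ H₂(N) + 1/(N+1)` where `H₂(N) = Σ_{m ≤ N} 1/(m+1)²`. [folklore] -/
theorem li2E_one_le_partial (N : ℕ) :
    li2E 1 ≤ (∑ m ∈ Finset.range (N + 1), ENNReal.ofReal (1 / ((m : ℝ) + 1) ^ 2)) +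
      ENNReal.ofReal (1 / ((N : ℝ) + 1)) := by
  rw [li2E_one, ← Summable.sum_add_tsum_nat_add'
    (f := fun m : ℕ => ENNReal.ofReal (1 / ((m : ℝ) + 1) ^ 2)) (k := N + 1) ENNReal.summable]
  refine add_le_add le_rfl (ENNReal.tsum_le_of_sum_range_le fun M => ?_)
  rw [← ENNReal.ofReal_sum_of_nonneg (fun j _ => by positivity)]
  apply ENNReal.ofReal_le_ofReal
  convert sum_inv_sq_tail_le N M using 2 with j
  push_cast
  ring

/-- `Li_{1,2}` regrouped along antidiagonals: `Σ_N H₂(N) · x^{N+2}/(N+2)`. [folklore] -/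
theorem li12E_eq_tsum_antidiagonal (x : ℝ) :
    li12E x = ∑' N : ℕ, (∑ m ∈ Finset.range (N + 1), ENNReal.ofReal (1 / ((m : ℝ) + 1) ^ 2)) *
      ENNReal.ofReal (x ^ (N + 2) / ((N : ℝ) + 2)) := by
  set G : ℕ × ℕ → ℝ≥0∞ := fun p => ENNReal.ofReal (1 / ((p.1 : ℝ) + 1) ^ 2) *
    ENNReal.ofReal (x ^ (p.1 + 1 + p.2 + 1) / ((p.1 + 1 + p.2 + 1 : ℕ) : ℝ)) with hG
  have key : li12E x = ∑' s : (Σ N : ℕ, Finset.HasAntidiagonal.antidiagonal N),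
      G (Finset.HasAntidiagonal.sigmaAntidiagonalEquivProd s) := by
    rw [li12E, Equiv.tsum_eq]
  rw [key, ENNReal.tsum_sigma']
  refine tsum_congr fun N => ?_
  rw [tsum_fintype, Finset.sum_mul]
  simp only [Finset.HasAntidiagonal.sigmaAntidiagonalEquivProd_apply]
  rw [Finset.sum_coe_sort (Finset.HasAntidiagonal.antidiagonal N) G, Finset.Nat.sum_antidiagonal_eq_sum_range_succ_mk]
  refine Finset.sum_congr rfl fun m hm => ?_
  have hmN : m ≤ N := Nat.lt_succ_iff.mp (Finset.mem_range.mp hm)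
  have h1 : m + 1 + (N - m) + 1 = N + 2 := by omega
  simp only [hG, h1]
  push_cast
  ring_nf

/-- **Lower bound**: `ζ₂ · ℓ(x) ≤ Li_{1,2}(x) + 2ζ₂` for `0 ≤ x ≤ 1`. [folklore] -/
theorem li2E_one_mul_ellE_le {x : ℝ} (hx0 : 0 ≤ x) (hx1 : x ≤ 1) :
    li2E 1 * ellE x ≤ li12E x + 2 * li2E 1 := by
  -- abbreviations
  set Z := li2E 1 with hZ
  set c : ℕ → ℝ≥0∞ := fun N => ENNReal.ofReal (x ^ (N + 2) / ((N : ℝ) + 2)) with hc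
  set H : ℕ → ℝ≥0∞ := fun N => ∑ m ∈ Finset.range (N + 1), ENNReal.ofReal (1 / ((m : ℝ) + 1) ^ 2)
    with hH
  -- split off the first term of ℓ
  have hsplit : ellE x = ENNReal.ofReal x + ∑' N : ℕ, c N := by
    rw [ellE, tsum_eq_zero_add' (f := fun m : ℕ => ENNReal.ofReal (x ^ (m + 1) / ((m : ℝ) + 1)))
      ENNReal.summable]
    simp only [Nat.cast_zero, zero_add, pow_one, div_one]
    congr 1
    refine tsum_congr fun N => ?_
    simp only [hc]
    push_cast
    ring_nf
  have hanti : li12E x = ∑' N : ℕ, H N * c N := li12E_eq_tsum_antidiagonal x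
  have hx' : ENNReal.ofReal x ≤ 1 := by
    rw [← ENNReal.ofReal_one]; exact ENNReal.ofReal_le_ofReal hx1
  have h1 : Z * ENNReal.ofReal x ≤ Z := (mul_le_mul' le_rfl hx').trans_eq (mul_one _)
  -- termwise: Z c_N ≤ H(N) c_N + (1/(N+1)) c_N ≤ H(N) c_N + 1/(N+1)²
  have hterm : ∀ N : ℕ, Z * c N ≤ H N * c N + ENNReal.ofReal (1 / ((N : ℝ) + 1) ^ 2) := by
    intro N
    refine (mul_le_mul' (li2E_one_le_partial N) le_rfl).trans ?_
    rw [add_mul]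
    refine add_le_add le_rfl ?_
    simp only [hc]
    rw [← ENNReal.ofReal_mul (by positivity)]
    apply ENNReal.ofReal_le_ofReal
    have hN : (0 : ℝ) < N + 1 := by positivity
    have hxN : x ^ (N + 2) ≤ 1 := pow_le_one₀ hx0 hx1
    calc 1 / ((N : ℝ) + 1) * (x ^ (N + 2) / ((N : ℝ) + 2))
        ≤ 1 / ((N : ℝ) + 1) * (1 / ((N : ℝ) + 1)) := by
          refine mul_le_mul_of_nonneg_left ?_ (by positivity)
          rw [div_le_div_iff₀ (by positivity) hN]
          nlinarith
      _ = 1 / ((N : ℝ) + 1) ^ 2 := by rw [div_mul_div_comm, one_mul, sq]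
  have h2 : ∑' N : ℕ, Z * c N ≤ li12E x + Z := by
    calc ∑' N : ℕ, Z * c N
        ≤ ∑' N : ℕ, (H N * c N + ENNReal.ofReal (1 / ((N : ℝ) + 1) ^ 2)) :=
          ENNReal.tsum_le_tsum hterm
      _ = (∑' N : ℕ, H N * c N) + ∑' N : ℕ, ENNReal.ofReal (1 / ((N : ℝ) + 1) ^ 2) :=
          ENNReal.tsum_add
      _ = li12E x + Z := by rw [← hanti, hZ, li2E_one]
  calc Z * ellE x = Z * ENNReal.ofReal x + ∑' N : ℕ, Z * c N := by
        rw [hsplit, mul_add, ENNReal.tsum_mul_left]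
    _ ≤ Z + (li12E x + Z) := add_le_add h1 h2
    _ = li12E x + 2 * Z := by rw [two_mul]; ring

/-! ### Real bounds for the marginal -/

/-- The real constant `ζ₂ = (Li₂ 1).toReal` is the value of `[Δ₂]`. -/
theorem Z_eq : (li2E 1).toReal = ζ₂ := ζ₂_eq.symm

/-- `ℓ(x) = (ellE x).toReal` for `0 ≤ x < 1`. [folklore] -/
theorem ell_eq_toReal {x : ℝ} (hx0 : 0 ≤ x) (hx1 : x < 1) :
    -Real.log (1 - x) = (ellE x).toReal := by
  rw [ellE_eq_ofReal hx0 hx1, ENNReal.toReal_ofReal]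
  have : Real.log (1 - x) ≤ 0 := Real.log_nonpos (by linarith) (by linarith)
  linarith

/-- The numerator `F(x) = ζ₂ ℓ(x) − 2 Li_{1,2}(x) − Li₃(x)` of the marginal. -/
def F (x : ℝ) : ℝ := ζ₂ * (-Real.log (1 - x)) - 2 * (li12E x).toReal - (li3E x).toReal

/-- **Two-sided bound**: `−ζ₂ ℓ(x) − ζ₂ ≤ F(x) ≤ −ζ₂ ℓ(x) + 4ζ₂` on `[0,1)`. -/
theorem F_bounds {x : ℝ} (hx0 : 0 ≤ x) (hx1 : x < 1) :
    -ζ₂ * (-Real.log (1 - x)) - ζ₂ ≤ F x ∧ F x ≤ -ζ₂ * (-Real.log (1 - x)) + 4 * ζ₂ := by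
  have hZtop : li2E 1 ≠ ∞ := li2E_one_ne_top
  have hEtop : ellE x ≠ ∞ := by rw [ellE_eq_ofReal hx0 hx1]; exact ENNReal.ofReal_ne_top
  have h3 : (li3E x).toReal ≤ ζ₂ := by
    rw [← Z_eq]; exact ENNReal.toReal_mono hZtop (li3E_le hx0 hx1.le)
  have h3nn : 0 ≤ (li3E x).toReal := ENNReal.toReal_nonneg
  have h12 : (li12E x).toReal ≤ ζ₂ * (-Real.log (1 - x)) := by
    rw [← Z_eq, ell_eq_toReal hx0 hx1, ← ENNReal.toReal_mul]
    exact ENNReal.toReal_mono (ENNReal.mul_ne_top hZtop hEtop) (li12E_le hx0 hx1.le)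
  have h12top : li12E x ≠ ∞ :=
    ne_top_of_le_ne_top (ENNReal.mul_ne_top hZtop hEtop) (li12E_le hx0 hx1.le)
  have h2Z : 2 * li2E 1 ≠ ∞ := ENNReal.mul_ne_top (by simp) hZtop
  have hlow : ζ₂ * (-Real.log (1 - x)) ≤ (li12E x).toReal + 2 * ζ₂ := by
    rw [← Z_eq, ell_eq_toReal hx0 hx1, ← ENNReal.toReal_mul]
    have := ENNReal.toReal_mono (ENNReal.add_ne_top.mpr ⟨h12top, h2Z⟩) (li2E_one_mul_ellE_le hx0 hx1.le)
    rw [ENNReal.toReal_add h12top h2Z, ENNReal.toReal_mul, ENNReal.toReal_mul,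
      ENNReal.toReal_ofNat] at this
    rwa [ENNReal.toReal_mul]
  constructor <;> · unfold F; nlinarith

/-! ### Asymptotics of the marginal as `x → 1⁻` -/

/-- `1 − s → 0⁺` as `s → 1⁻`. [folklore] -/
theorem tendsto_one_sub : Tendsto (fun s : ℝ => 1 - s) (𝓝[<] (1 : ℝ)) (𝓝[>] 0) := by
  rw [tendsto_nhdsWithin_iff]
  refine ⟨?_, ?_⟩
  · have : Tendsto (fun s : ℝ => 1 - s) (𝓝 (1 : ℝ)) (𝓝 (1 - 1)) :=
      (tendsto_const_nhds.sub tendsto_id)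
    rw [sub_self] at this
    exact this.mono_left nhdsWithin_le_nhds
  · filter_upwards [self_mem_nhdsWithin] with s hs
    exact sub_pos.mpr (show s < 1 from hs)

/-- `ℓ(s) = −log(1−s) → +∞` as `s → 1⁻`. [folklore] -/
theorem tendsto_ell_atTop : Tendsto (fun s : ℝ => -Real.log (1 - s)) (𝓝[<] (1 : ℝ)) atTop :=
  tendsto_neg_atBot_atTop.comp (Real.tendsto_log_nhdsGT_zero.comp tendsto_one_sub)

/-- `u · (log u)^k → 0` as `u → 0⁺`. [folklore] -/
theorem tendsto_mul_log_pow (k : ℕ) (hk : 1 ≤ k) :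
    Tendsto (fun u : ℝ => u * Real.log u ^ k) (𝓝[>] (0 : ℝ)) (𝓝 0) := by
  have hr : (0 : ℝ) < 1 / k := by
    have : (0 : ℝ) < k := by exact_mod_cast hk
    positivity
  have h := (tendsto_log_mul_rpow_nhdsGT_zero hr).pow k
  rw [zero_pow (by omega)] at h
  refine h.congr' ?_
  filter_upwards [self_mem_nhdsWithin] with u hu
  rw [mul_pow, ← Real.rpow_natCast (u ^ (1 / (k : ℝ))) k, ← Real.rpow_mul hu.le,
    one_div_mul_cancel (by exact_mod_cast (show k ≠ 0 by omega)), Real.rpow_one, mul_comm]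

/-- `(1 − s) ℓ(s)^k → 0` as `s → 1⁻`. [folklore] -/
theorem tendsto_one_sub_mul_ell_pow (k : ℕ) (hk : 1 ≤ k) :
    Tendsto (fun s : ℝ => (1 - s) * (-Real.log (1 - s)) ^ k) (𝓝[<] (1 : ℝ)) (𝓝 0) := by
  have h := ((tendsto_mul_log_pow k hk).comp tendsto_one_sub).const_mul ((-1 : ℝ) ^ k)
  rw [mul_zero] at h
  refine h.congr' (Eventually.of_forall fun s => ?_)
  simp only [Function.comp_apply]
  rw [neg_pow]
  ring

/-- Eventually (as `s → 1⁻`) `s ∈ (a, 1)`, for `a < 1`. [folklore] -/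
theorem eventually_mem_Ioo (a : ℝ) (ha : a < 1) : ∀ᶠ s in 𝓝[<] (1 : ℝ), s ∈ Ioo a 1 := by
  have h1 : ∀ᶠ s in 𝓝[<] (1 : ℝ), s ∈ Iio (1 : ℝ) := self_mem_nhdsWithin
  have h2 : ∀ᶠ s in 𝓝[<] (1 : ℝ), s ∈ Ioi a := nhdsWithin_le_nhds (Ioi_mem_nhds ha)
  filter_upwards [h1, h2] with s hs1 hs2
  exact ⟨hs2, hs1⟩

/-- The marginal `ρ = sliceEval D`. -/
abbrev ρ : ℝ → ℝ := sliceEval (defect Zcan [2] [2])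

/-- On `(0,1)`, `ρ x = F(x)/x`. -/
theorem ρ_eq {x : ℝ} (hx : x ∈ Ioo (0 : ℝ) 1) : ρ x = 1 / x * F x := by
  rw [ρ, sliceEval_defect_two_two hx, F]

/-- **`ρ → −∞` as `x → 1⁻`.** -/
theorem tendsto_ρ_atBot : Tendsto ρ (𝓝[<] (1 : ℝ)) atBot := by
  have hZ := ζ₂_pos
  -- the majorant −ζ₂ ℓ + 4ζ₂ → −∞
  have hmaj : Tendsto (fun s : ℝ => -ζ₂ * (-Real.log (1 - s)) + 4 * ζ₂) (𝓝[<] (1 : ℝ)) atBot := by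
    refine tendsto_atBot_add_const_right _ _ ?_
    exact (tendsto_ell_atTop.const_mul_atTop_of_neg (by linarith))
  refine tendsto_atBot_mono' _ ?_ hmaj
  have hev1 : ∀ᶠ s in 𝓝[<] (1 : ℝ), -ζ₂ * (-Real.log (1 - s)) + 4 * ζ₂ ≤ 0 :=
    hmaj.eventually (eventually_le_atBot 0)
  have hev2 : ∀ᶠ s in 𝓝[<] (1 : ℝ), s ∈ Ioo (0 : ℝ) 1 := eventually_mem_Ioo 0 one_pos
  filter_upwards [hev1, hev2] with s h1 hs
  have hF := (F_bounds hs.1.le hs.2).2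
  have hFneg : F s ≤ 0 := hF.trans h1
  rw [ρ_eq hs]
  -- F/s ≤ F ≤ majorant (F ≤ 0, 0 < s < 1)
  have : 1 / s * F s ≤ F s := by
    rw [one_div, inv_mul_le_iff₀ hs.1]
    nlinarith [hs.2, hFneg]
  exact this.trans hF

/-- **Sub-polynomial growth**: `(1 − s) ρ(s)^k → 0` as `s → 1⁻`, for every `k ≥ 1`. -/
theorem tendsto_one_sub_mul_ρ_pow (k : ℕ) (hk : 1 ≤ k) :
    Tendsto (fun s : ℝ => (1 - s) * ρ s ^ k) (𝓝[<] (1 : ℝ)) (𝓝 0) := by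
  have hZ := ζ₂_pos
  set A : ℝ := 10 * ζ₂ with hA
  have hg : Tendsto (fun s : ℝ => A ^ k * ((1 - s) * (-Real.log (1 - s)) ^ k)) (𝓝[<] (1 : ℝ)) (𝓝 0) := by
    have := (tendsto_one_sub_mul_ell_pow k hk).const_mul (A ^ k)
    rwa [mul_zero] at this
  refine squeeze_zero_norm' ?_ hg
  have hev2 : ∀ᶠ s in 𝓝[<] (1 : ℝ), s ∈ Ioo (1 / 2 : ℝ) 1 := eventually_mem_Ioo _ (by norm_num)
  have hev3 : ∀ᶠ s in 𝓝[<] (1 : ℝ), 1 ≤ -Real.log (1 - s) := tendsto_ell_atTop.eventually (eventually_ge_atTop 1)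
  filter_upwards [hev2, hev3] with s hs hℓ
  have hs0 : 0 < s := by linarith [hs.1]
  have hs' : s ∈ Ioo (0 : ℝ) 1 := ⟨hs0, hs.2⟩
  obtain ⟨hlo, hhi⟩ := F_bounds hs0.le hs.2
  -- |ρ s| ≤ 2 |F s| ≤ 2 (ζ₂ ℓ + 4 ζ₂) ≤ 10 ζ₂ ℓ
  have hFabs : |F s| ≤ ζ₂ * (-Real.log (1 - s)) + 4 * ζ₂ := by
    rw [abs_le]; constructor <;> nlinarith
  have hρabs : |ρ s| ≤ A * (-Real.log (1 - s)) := by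
    rw [ρ_eq hs', abs_mul, abs_of_pos (by positivity : (0 : ℝ) < 1 / s)]
    have h2 : 1 / s ≤ 2 := by rw [div_le_iff₀ hs0]; linarith [hs.1]
    calc 1 / s * |F s| ≤ 2 * (ζ₂ * (-Real.log (1 - s)) + 4 * ζ₂) :=
          mul_le_mul h2 hFabs (abs_nonneg _) (by norm_num)
      _ ≤ A * (-Real.log (1 - s)) := by rw [hA]; nlinarith
  rw [Real.norm_eq_abs, abs_mul, abs_of_nonneg (by linarith [hs.2] : (0 : ℝ) ≤ 1 - s), abs_pow]
  calc (1 - s) * |ρ s| ^ k ≤ (1 - s) * (A * (-Real.log (1 - s))) ^ k := by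
        refine mul_le_mul_of_nonneg_left ?_ (by linarith [hs.2])
        exact pow_le_pow_left₀ (abs_nonneg _) hρabs k
    _ = A ^ k * ((1 - s) * (-Real.log (1 - s)) ^ k) := by rw [mul_pow]; ring

/-! ### Assembly -/

open scoped Polynomial.Bivariate in
/-- **The (2,2) stuffle defect has NO algebraic shadow.** -/
theorem defect_two_two_not_hasAlgShadow : ¬ HasAlgShadow (defect Zcan [2] [2]) := by
  rintro ⟨g, hg, hae⟩
  obtain ⟨P, hP0, hPv⟩ :=
    Literature.Barriers.KontsevichZagierPeriods.KZ.NoSemialgPrimKernel.exists_ne_zero_evalEval_eq_zero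
      (hg.mono (subset_univ _) LogShadow.isSemialgebraic_Icc01)
  apply hP0
  -- the set where the identity holds for ρ
  set E : Set ℝ := {t | P.evalEval t (ρ t) = 0} with hE
  have haeE : ∀ᵐ t ∂volume, t ∈ Ioo (0 : ℝ) 1 → t ∈ E := by
    filter_upwards [hae] with t ht hmem
    show P.evalEval t (ρ t) = 0
    rw [ρ, ht]
    exact hPv t (Ioo_subset_Icc_self hmem)
  -- the filter 𝓝[<] 1 ⊓ 𝓟 E is non-trivial: E has full measure in every (1-δ, 1)
  set l : Filter ℝ := 𝓝[<] (1 : ℝ) ⊓ 𝓟 E with hl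
  have hlE : l = 𝓝[Iio 1 ∩ E] 1 := by rw [hl, nhdsWithin_inter']
  haveI : l.NeBot := by
    rw [hlE, ← mem_closure_iff_nhdsWithin_neBot, Metric.mem_closure_iff]
    intro δ hδ
    by_contra hno
    push Not at hno
    -- then (max (1-δ) 0, 1) ∩ E = ∅ up to… but a.e. point of (0,1) is in E
    set a : ℝ := max (1 - δ / 2) (1 / 2) with ha
    have ha1 : a < 1 := by
      rw [ha, max_lt_iff]; constructor <;> linarith
    have hsub : ∀ᵐ t ∂volume, t ∉ Ioo a 1 := by
      filter_upwards [haeE] with t ht hta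
      have ht01 : t ∈ Ioo (0 : ℝ) 1 := ⟨by linarith [hta.1, le_max_right (1 - δ / 2) (1 / 2 : ℝ)], hta.2⟩
      have htE := ht ht01
      have hdist : dist 1 t < δ := by
        rw [Real.dist_eq, abs_of_nonneg (by linarith [hta.2])]
        linarith [hta.1, le_max_left (1 - δ / 2) (1 / 2 : ℝ)]
      exact (hno t ⟨hta.2, htE⟩).not_gt hdist
    have hnull : volume (Ioo a 1) = 0 := measure_eq_zero_iff_ae_notMem.mpr hsub
    rw [Real.volume_Ioo, ENNReal.ofReal_eq_zero] at hnull
    linarith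
  have hle : l ≤ 𝓝[<] (1 : ℝ) := inf_le_left
  refine Growth.eq_zero_of_evalEval_of_subpolynomial (l := l) hle
    (tendsto_ρ_atBot.mono_left hle) (fun k hk => (tendsto_one_sub_mul_ρ_pow k hk).mono_left hle) P ?_
  exact mem_inf_of_right (mem_principal_self E)

/-- **A CHANGE OF VARIABLES IS NECESSARY FOR THE STUFFLE**: the crux fails in the CoV-free
sub-calculus `closure (domainAddRel ∪ integrandAddRel ∪ newtonLeibnizRel)`. -/
theorem not_stuffleInCovFree : ¬ StuffleInCovFree :=
  fun h => defect_two_two_not_hasAlgShadow (stuffleInCovFree_imp_hasAlgShadow h)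

/-- … concretely: the first genuine defect `[Δ₂]² − 2[Δ_{2,2}] − [Δ₄]` is not a CoV-free relation. -/
theorem defect_two_two_not_mem_covFreeRelations : defect Zcan [2] [2] ∉ covFreeRelations :=
  fun h => defect_two_two_not_hasAlgShadow (covFreeRelations_le_algShadow h)

/-- **Sharper: a change of variables MOVING THE FIRST (largest simplex) COORDINATE is necessary.**
The defect is not generated by ALL fibred moves (rules (1a), (1b), changes of variables with
`Φ z 0 = z 0`, Newton–Leibniz over bases of dimension `≥ 1`) together with ALL Newton–Leibniz moves:
a chain whose every change of variables fixes `z₀` cannot prove the stuffle. (In the cubical chain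
the cubical map `tᵢ = x₀⋯xᵢ` fixes `t₀ = x₀`; the indispensable non-fibred move is the BLOCK SWAP.) -/
theorem defect_two_two_not_mem_closure_fibred_nl :
    defect Zcan [2] [2] ∉ AddSubgroup.closure (fibredGenerators ∪ newtonLeibnizRel) :=
  fun h => defect_two_two_not_hasAlgShadow (closure_fibred_nl_le_algShadow h)

/-- The crux with `relations` replaced by the closure of all fibred moves and all NL moves. -/
def StuffleInFibredNL : Prop :=
  ∀ Z : List ℕ → FormalRep, (∀ (u : List ℕ) (hu : IsAdmissible u), Z u = simplexOf u hu) →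
    ∀ s t, IsAdmissible s → IsAdmissible t →
      defect Z s t ∈ AddSubgroup.closure (fibredGenerators ∪ newtonLeibnizRel)

/-- **Refuted**: the stuffle is not provable by fibred moves + Newton–Leibniz. -/
theorem not_stuffleInFibredNL : ¬ StuffleInFibredNL :=
  fun h => defect_two_two_not_mem_closure_fibred_nl (h Zcan isPinned_Zcan' [2] [2] (by decide) (by decide))

end Necessary

end Summit.KontsevichZagierPeriods.Theorems.StuffleInKZ.Negative
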